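import Literature.Geometry.Riemannian.MeanConvexEuclideanImmersion
import Literature.Geometry.Riemannian.LevelSetMeanCurvature
import Literature.Topology.FourManifolds.EuclideanRegularDomain
import Mathlib.Topology.Algebra.Module.Multilinear.Topology
import HarnessLib

/-!
# Regular compact domains of `ℝᵐ⁺¹` with Lawson–Michelsohn mean-convex boundary are PSC with mean-convex boundary
(topic `Geometry/Riemannian`)

Proof file for the named fact `Literature.Geometry.Riemannian.Sweeney2026_pscMeanConvex`
(`MeanConvexContractible.lean`; Sweeney 2026, Prop. 1.2, "following Lawson–Michelsohn,
Invent. Math. 77 (1984)"). PROVED here (`pscMeanConvex_of_hessianMeanConvexDomain`): for a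
regular compact domain `D = {F ≤ 0} ⊂ ℝᵐ⁺¹`, `m ≥ 1` (`IsRegularCompactDomain F`,
`EuclideanRegularDomain.lean`), whose boundary satisfies the conclusion clause of the tree's
Lawson–Michelsohn fact `LawsonMichelsohn1984_surrounding` — `∑ᵢ Hess F_x(vᵢ, vᵢ) > 0` for every
`x ∈ {F = 0}` and every orthonormal `m`-frame `v` of `ker dF_x` — the compact manifold with
boundary `D` carries, relative to ANY boundary datum, a Riemannian metric with Levi-Civita
connection and positive scalar curvature whose boundary is a spacelike immersion with a smooth
outward unit normal of positive mean curvature (the conclusion of Prop. 1.2). Together with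
`pscMeanConvex_of_diffeomorph` (`MeanConvexContractibleTransport.lean`) this reduces the `n ≥ 4`
clause of the fact to topology: realising a compact contractible `X` with `π₁(X, ∂X) = 0` inside
`ℝⁿ⁺¹` and Lawson–Michelsohn's theorem itself.

Ingredients (all proved):
* `HalfSliceAtlas.mfderiv_comp_val_eq_vec` — vector-valued version of
  `HalfSliceAtlas.mfderiv_comp_val_eq` (`RegularSublevelSet.lean`): differentials of restrictions
  read in half-slice charts; hence `mfderiv_incl_eq`, `fderiv_chart_comp_mfderiv_incl`
  (`d(Θₚ ∘ of) ∘ dι = id`, `dι ∘ d(Θₚ ∘ of) = id`), `mfderiv_incl_injective`,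
  `inverse_mfderiv_incl`;
* `inverse_mfderiv_incl_apply_zero` — OUTWARDNESS through the defining function: at a boundary
  point the `0`-th half-space coordinate of `(dι)⁻¹ w` is `-dF(w)` (the straightening chart of
  `sublevelAtlas` has `0`-th coordinate `-F`, `sublevelAtlas_datum_apply_zero_of_eq`), so
  `∇F/‖∇F‖` points outward;
* `exists_pos_le_hessianFrameSum` — compactness of `{(x, v) : F x = 0, v orthonormal ⊆ ker dF_x}`
  gives a uniform `H₀ > 0` with `‖∇F‖⁻¹ ∑ᵢ Hess F(vᵢ, vᵢ) ≥ H₀`;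
* the assembly feeds `ι`, `Y = unitGradient F` (`LevelSetMeanCurvature.lean`:
  `meanCurvature_unitGradient_eq_sum`) into the big-sphere theorem
  `pscMeanConvex_of_flatMeanConvexImmersion` (`MeanConvexEuclideanImmersion.lean`).

## References

* P. Sweeney Jr., *Positive curvature conditions on contractible manifolds*, Math. Ann. (2026)
  = arXiv:2507.15719, Prop. 1.2 (p. 4). [Sweeney2026]
* H. B. Lawson, M.-L. Michelsohn, *Embedding and surrounding with positive mean curvature*,
  Invent. Math. 77 (1984) 399–419, Thm. (6.1), §2. [LawsonMichelsohn1984]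
* J. Milnor, *Lectures on the h-cobordism theorem* (1965), Lemma 2.9 (straightening charts).
  [MilnorHCobordism1965]
-/

noncomputable section

open Bundle Set Function Metric Module Filter
open scoped Manifold ContDiff Topology RealInnerProductSpace Gradient

universe u

/-! ### Vector-valued functions on a regular domain, read in half-slice charts -/

namespace Literature.Topology.FourManifolds

namespace HalfSliceAtlas

variable {k : ℕ} {H : Type*} [TopologicalSpace H]
  {I : ModelWithCorners ℝ (EuclideanSpace ℝ (Fin (k + 1))) H}
  {M : Type u} [TopologicalSpace M] [ChartedSpace H M] {S : Set M} (Φ : HalfSliceAtlas I S)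
  {V : Type*} [NormedAddCommGroup V] [NormedSpace ℝ V]

/-- The restriction `G|_S` of a vector-valued function on `M`, written in the preferred extended
chart of `S` at `p`, agrees with `G ∘ Θₚ.symm` on the half-space part of the target of the
half-slice chart at `p` (the vector-valued version of `writtenInExtChartAt_comp_val_eventuallyEq`).
[folklore] -/
theorem writtenInExtChartAt_comp_val_eventuallyEq_vec (G : M → V) (p : S) :
    letI := Φ.chartedSpace
    writtenInExtChartAt (𝓡∂ (k + 1)) 𝓘(ℝ, V) p (G ∘ Subtype.val)
      =ᶠ[𝓝[range (𝓡∂ (k + 1))] ((Φ.datum p).Θ p.1)] G ∘ (Φ.datum p).Θ.symm := by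
  letI := Φ.chartedSpace
  have hmem : (Φ.datum p).Θ.target ∈ 𝓝[range (𝓡∂ (k + 1))] ((Φ.datum p).Θ p.1) :=
    mem_nhdsWithin_of_mem_nhds ((Φ.datum p).Θ.open_target.mem_nhds
      ((Φ.datum p).Θ.map_source (Φ.mem_source p)))
  filter_upwards [hmem, self_mem_nhdsWithin] with z hz hzr
  rw [range_modelWithCornersEuclideanHalfSpace] at hzr
  have hz0 : 0 ≤ z 0 := hzr
  simp only [writtenInExtChartAt, comp_apply, extChartAt, OpenPartialHomeomorph.extend,
    PartialEquiv.coe_trans, ModelWithCorners.toPartialEquiv_coe, modelWithCornersSelf_coe, id_eq,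
    OpenPartialHomeomorph.toFun_eq_coe, chartAt_self_eq, OpenPartialHomeomorph.refl_apply,
    PartialEquiv.coe_trans_symm, OpenPartialHomeomorph.coe_toPartialEquiv_symm,
    ModelWithCorners.toPartialEquiv_coe_symm]
  rw [chartAt_eq, (Φ.datum p).coe_chart_symm_of_mem, modelHalf_apply_symm hz0]
  rw [HalfSliceChart.mem_chart_target, modelHalf_apply_symm hz0]; exact hz

/-- **The differential of the restriction of a vector-valued map, read in a half-slice chart**:
for `G : M → V` with `G|_S` differentiable at `p` and `G ∘ Θₚ.symm` differentiable at `Θₚ p`,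
`d(G|_S)_p = d(G ∘ Θₚ.symm)(Θₚ p)` (vector-valued version of `mfderiv_comp_val_eq`). [folklore] -/
theorem mfderiv_comp_val_eq_vec (G : M → V) (p : S)
    (hGS : letI := Φ.chartedSpace; MDifferentiableAt (𝓡∂ (k + 1)) 𝓘(ℝ, V) (G ∘ Subtype.val) p)
    (hG : DifferentiableAt ℝ (G ∘ (Φ.datum p).Θ.symm) ((Φ.datum p).Θ p.1)) :
    letI := Φ.chartedSpace
    mfderiv (𝓡∂ (k + 1)) 𝓘(ℝ, V) (G ∘ Subtype.val) p =
      fderiv ℝ (G ∘ (Φ.datum p).Θ.symm) ((Φ.datum p).Θ p.1) := by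
  letI := Φ.chartedSpace
  rw [hGS.mfderiv, Φ.extChartAt_self_apply,
    (Φ.writtenInExtChartAt_comp_val_eventuallyEq_vec G p).fderivWithin_eq_of_mem
      (mem_range_modelHalf ((Φ.datum p).apply_zero_nonneg (Φ.mem_source p) p.2)),
    hG.fderivWithin ((𝓡∂ (k + 1)).uniqueDiffOn _
      (mem_range_modelHalf ((Φ.datum p).apply_zero_nonneg (Φ.mem_source p) p.2)))]

end HalfSliceAtlas

end Literature.Topology.FourManifolds

namespace Literature.Geometry.Riemannian

open Literature.Topology.FourManifolds IsRegularCompactDomain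

variable {m : ℕ}

variable {F : EuclideanSpace ℝ (Fin (m + 1)) → ℝ}

/-- `Θₚ.symm` followed by the identity `HalfSpaceCharted ℝᵐ⁺¹ → ℝᵐ⁺¹` is smooth on the target
of the half-slice chart. [folklore] -/
theorem contDiffOn_of_symm_comp_symm (h : IsRegularCompactDomain F) (p : h.Domain) :
    ContDiffOn ℝ ∞ ((HalfSpaceCharted.of (X := EuclideanSpace ℝ (Fin (m + 1)))).symm ∘ (h.atlas.datum p).Θ.symm)
      (h.atlas.datum p).Θ.target :=
  contMDiffOn_iff_contDiffOn.1
    (Domain.contMDiff_of_symm.comp_contMDiffOn (h.atlas.datum p).contMDiffOn_symm)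

/-- **The differential of the inclusion of a regular compact domain, read in the half-slice
chart at `p`, is `d(Θₚ⁻¹)(Θₚ p)`.** [folklore] -/
theorem mfderiv_incl_eq (h : IsRegularCompactDomain F) (hm : 1 ≤ m) (p : h.Domain) :
    mfderiv (𝓡∂ (m + 1)) 𝓘(ℝ, EuclideanSpace ℝ (Fin (m + 1))) (Domain.incl h) p =
      fderiv ℝ ((HalfSpaceCharted.of (X := EuclideanSpace ℝ (Fin (m + 1)))).symm ∘ (h.atlas.datum p).Θ.symm)
        ((h.atlas.datum p).Θ p.1) :=
  h.atlas.mfderiv_comp_val_eq_vec (HalfSpaceCharted.of (X := EuclideanSpace ℝ (Fin (m + 1)))).symm p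
    ((Domain.contMDiff_incl h hm p).mdifferentiableAt (by simp))
    (((contDiffOn_of_symm_comp_symm h p).differentiableOn (by simp)).differentiableAt
      ((h.atlas.datum p).Θ.open_target.mem_nhds ((h.atlas.datum p).Θ.map_source (h.atlas.mem_source p))))

/-- The half-slice chart read on `ℝᵐ⁺¹` (through the identity `ℝᵐ⁺¹ → HalfSpaceCharted ℝᵐ⁺¹`) is
smooth at the points of the domain near `p`. [folklore] -/
theorem contDiffAt_chart_comp_of (h : IsRegularCompactDomain F) (p : h.Domain)
    {y : EuclideanSpace ℝ (Fin (m + 1))} (hy : HalfSpaceCharted.of y ∈ (h.atlas.datum p).Θ.source) :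
    ContDiffAt ℝ ∞ ((h.atlas.datum p).Θ ∘ HalfSpaceCharted.of) y := by
  have h1 : ContMDiffAt (𝓡∂ (m + 1)) 𝓘(ℝ, EuclideanSpace ℝ (Fin (m + 1))) ∞
      (((h.atlas.datum p).Θ ∘ HalfSpaceCharted.of) ∘ (HalfSpaceCharted.of).symm)
      (HalfSpaceCharted.of y) :=
    (h.atlas.datum p).contMDiffOn_toFun.contMDiffAt ((h.atlas.datum p).Θ.open_source.mem_nhds hy)
  exact (HalfSpaceCharted.contMDiffAt_iff.1 h1).contDiffAt

/-- **The differential of the inclusion and the differential of the chart are inverse to each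
other**: `d(Θₚ ∘ of)(ι p) ∘ dι_p = id` and `dι_p ∘ d(Θₚ ∘ of)(ι p) = id` (chain rule applied to
`Θₚ ∘ Θₚ⁻¹ = id` near `Θₚ p` and `Θₚ⁻¹ ∘ Θₚ = id` near `ι p`). [folklore] -/
theorem fderiv_chart_comp_mfderiv_incl (h : IsRegularCompactDomain F) (hm : 1 ≤ m) (p : h.Domain) :
    (fderiv ℝ ((h.atlas.datum p).Θ ∘ HalfSpaceCharted.of) (Domain.incl h p)).comp
        (mfderiv (𝓡∂ (m + 1)) 𝓘(ℝ, EuclideanSpace ℝ (Fin (m + 1))) (Domain.incl h) p) =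
        ContinuousLinearMap.id ℝ _ ∧
      (mfderiv (𝓡∂ (m + 1)) 𝓘(ℝ, EuclideanSpace ℝ (Fin (m + 1))) (Domain.incl h) p).comp
        (fderiv ℝ ((h.atlas.datum p).Θ ∘ HalfSpaceCharted.of) (Domain.incl h p)) =
        ContinuousLinearMap.id ℝ _ := by
  rw [mfderiv_incl_eq h hm p]
  set D := h.atlas.datum p with hD
  set x : EuclideanSpace ℝ (Fin (m + 1)) := Domain.incl h p with hx
  have hps : p.1 ∈ D.Θ.source := h.atlas.mem_source p
  have hxs : HalfSpaceCharted.of x ∈ D.Θ.source := hps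
  have hpt : D.Θ p.1 ∈ D.Θ.target := D.Θ.map_source hps
  set T : EuclideanSpace ℝ (Fin (m + 1)) → EuclideanSpace ℝ (Fin (m + 1)) :=
    (HalfSpaceCharted.of (X := EuclideanSpace ℝ (Fin (m + 1)))).symm ∘ D.Θ.symm with hT
  set S₁ : EuclideanSpace ℝ (Fin (m + 1)) → EuclideanSpace ℝ (Fin (m + 1)) :=
    D.Θ ∘ HalfSpaceCharted.of with hS₁
  have hTd : DifferentiableAt ℝ T (D.Θ p.1) :=
    (((contDiffOn_of_symm_comp_symm h p).differentiableOn (by simp)).differentiableAt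
      (D.Θ.open_target.mem_nhds hpt))
  have hSd : DifferentiableAt ℝ S₁ x := (contDiffAt_chart_comp_of h p hxs).differentiableAt (by simp)
  have hTx : T (D.Θ p.1) = x := by
    show (HalfSpaceCharted.of (X := EuclideanSpace ℝ (Fin (m + 1)))).symm (D.Θ.symm (D.Θ p.1)) = _
    rw [D.Θ.left_inv hps]
    rfl
  have hSx : S₁ x = D.Θ p.1 := rfl
  have h1 : S₁ ∘ T =ᶠ[𝓝 (D.Θ p.1)] id := by
    filter_upwards [D.Θ.open_target.mem_nhds hpt] with z hz
    exact D.Θ.right_inv hz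
  have h2 : T ∘ S₁ =ᶠ[𝓝 x] id := by
    have ho : IsOpen ((HalfSpaceCharted.of (X := EuclideanSpace ℝ (Fin (m + 1)))) ⁻¹' D.Θ.source) :=
      D.Θ.open_source.preimage continuous_id
    filter_upwards [ho.mem_nhds hxs] with z hz
    exact D.Θ.left_inv hz
  have hSd' : DifferentiableAt ℝ S₁ (T (D.Θ p.1)) := by rw [hTx]; exact hSd
  have hTd' : DifferentiableAt ℝ T (S₁ x) := by rw [hSx]; exact hTd
  constructor
  · have := h1.fderiv_eq (𝕜 := ℝ)
    rw [fderiv_comp _ hSd' hTd, hTx, fderiv_id (𝕜 := ℝ)] at this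
    exact this
  · have := h2.fderiv_eq (𝕜 := ℝ)
    rw [fderiv_comp _ hTd' hSd, hSx, fderiv_id (𝕜 := ℝ)] at this
    exact this

/-- Hence **the differential of the inclusion of a regular compact domain is injective**.
[folklore] -/
theorem mfderiv_incl_injective (h : IsRegularCompactDomain F) (hm : 1 ≤ m) (p : h.Domain) :
    Injective (mfderiv (𝓡∂ (m + 1)) 𝓘(ℝ, EuclideanSpace ℝ (Fin (m + 1))) (Domain.incl h) p) := by
  intro v w hvw
  have key := congrArg (fderiv ℝ ((h.atlas.datum p).Θ ∘ HalfSpaceCharted.of) (Domain.incl h p)) hvw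
  have h1 : ∀ u : EuclideanSpace ℝ (Fin (m + 1)),
      fderiv ℝ ((h.atlas.datum p).Θ ∘ HalfSpaceCharted.of) (Domain.incl h p)
        (mfderiv (𝓡∂ (m + 1)) 𝓘(ℝ, EuclideanSpace ℝ (Fin (m + 1))) (Domain.incl h) p u) = u :=
    fun u ↦ congrArg (fun f : EuclideanSpace ℝ (Fin (m + 1)) →L[ℝ]
      EuclideanSpace ℝ (Fin (m + 1)) ↦ f u) (fderiv_chart_comp_mfderiv_incl h hm p).1
  exact (h1 v).symm.trans (key.trans (h1 w))

/-- **The inverse of the differential of the inclusion is the differential of the chart**: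
`(dι_p)⁻¹ = d(Θₚ ∘ of)(ι p)`. [folklore] -/
theorem inverse_mfderiv_incl (h : IsRegularCompactDomain F) (hm : 1 ≤ m) (p : h.Domain) :
    (mfderiv (𝓡∂ (m + 1)) 𝓘(ℝ, EuclideanSpace ℝ (Fin (m + 1))) (Domain.incl h) p).inverse =
      fderiv ℝ ((h.atlas.datum p).Θ ∘ HalfSpaceCharted.of) (Domain.incl h p) := by
  obtain ⟨hc1, hc2⟩ := fderiv_chart_comp_mfderiv_incl h hm p
  let e : EuclideanSpace ℝ (Fin (m + 1)) ≃L[ℝ] EuclideanSpace ℝ (Fin (m + 1)) :=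
    ContinuousLinearEquiv.equivOfInverse
      (mfderiv (𝓡∂ (m + 1)) 𝓘(ℝ, EuclideanSpace ℝ (Fin (m + 1))) (Domain.incl h) p)
      (fderiv ℝ ((h.atlas.datum p).Θ ∘ HalfSpaceCharted.of) (Domain.incl h p))
      (fun v ↦ congrArg (fun f : EuclideanSpace ℝ (Fin (m + 1)) →L[ℝ]
        EuclideanSpace ℝ (Fin (m + 1)) ↦ f v) hc1)
      (fun v ↦ congrArg (fun f : EuclideanSpace ℝ (Fin (m + 1)) →L[ℝ]
        EuclideanSpace ℝ (Fin (m + 1)) ↦ f v) hc2)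
  have he : (e : EuclideanSpace ℝ (Fin (m + 1)) →L[ℝ] EuclideanSpace ℝ (Fin (m + 1))) =
      mfderiv (𝓡∂ (m + 1)) 𝓘(ℝ, EuclideanSpace ℝ (Fin (m + 1))) (Domain.incl h) p := rfl
  rw [← he]
  exact ContinuousLinearMap.inverse_equiv e

/-- **Outwardness read through the defining function**: at a boundary point `p` of the regular
compact domain `{F ≤ 0}` (`F (ι p) = 0`), the `0`-th half-space coordinate of `(dι_p)⁻¹ w` is
`-dF_{ι p}(w)` — because the `0`-th coordinate of the straightening chart at `p` is `-F`
(`sublevelAtlas_datum_apply_zero_of_eq`). Hence the gradient direction is outward. [folklore] -/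
theorem inverse_mfderiv_incl_apply_zero (h : IsRegularCompactDomain F) (hm : 1 ≤ m) (p : h.Domain)
    (hp : F (Domain.incl h p) = 0) (w : EuclideanSpace ℝ (Fin (m + 1))) :
    (show EuclideanSpace ℝ (Fin (m + 1)) from
      (mfderiv (𝓡∂ (m + 1)) 𝓘(ℝ, EuclideanSpace ℝ (Fin (m + 1))) (Domain.incl h) p).inverse w) 0 =
      -fderiv ℝ F (Domain.incl h p) w := by
  rw [inverse_mfderiv_incl h hm p]
  set D := h.atlas.datum p with hD
  set x : EuclideanSpace ℝ (Fin (m + 1)) := Domain.incl h p with hx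
  have hxs : HalfSpaceCharted.of x ∈ D.Θ.source := h.atlas.mem_source p
  have hSd : DifferentiableAt ℝ (D.Θ ∘ HalfSpaceCharted.of) x :=
    (contDiffAt_chart_comp_of h p hxs).differentiableAt (by simp)
  -- the `0`-th coordinate of `Θₚ ∘ of` is `-F` near `x`
  have h0 : (⇑(EuclideanSpace.proj (0 : Fin (m + 1))) ∘ (D.Θ ∘ HalfSpaceCharted.of) :
      EuclideanSpace ℝ (Fin (m + 1)) → ℝ) =ᶠ[𝓝 x] (-F) := by
    have ho : IsOpen ((HalfSpaceCharted.of (X := EuclideanSpace ℝ (Fin (m + 1)))) ⁻¹' D.Θ.source) :=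
      D.Θ.open_source.preimage continuous_id
    filter_upwards [ho.mem_nhds hxs] with y hy
    have key := sublevelAtlas_datum_apply_zero_of_eq h.contMDiff_comp_symm 0
      (fun q _ ↦ isInteriorPoint_halfSpaceCharted q) (fun q hq ↦ h.not_isMCriticalPt q hq) p hp hy
    rw [zero_sub] at key
    exact key
  have hderiv : fderiv ℝ (⇑(EuclideanSpace.proj (0 : Fin (m + 1))) ∘ (D.Θ ∘ HalfSpaceCharted.of)) x =
      -fderiv ℝ F x := by
    rw [h0.fderiv_eq]
    exact fderiv_neg
  have hcomp := ((EuclideanSpace.proj (0 : Fin (m + 1))).hasFDerivAt.comp x hSd.hasFDerivAt).fderiv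
  exact congrArg (fun f : EuclideanSpace ℝ (Fin (m + 1)) →L[ℝ] ℝ ↦ f w) (hcomp.symm.trans hderiv)

end Literature.Geometry.Riemannian


namespace Literature.Geometry.Riemannian

variable {W : Type*} [NormedAddCommGroup W] [InnerProductSpace ℝ W] [FiniteDimensional ℝ W]

/-- **A uniform lower bound for Lawson–Michelsohn's Hessian mean curvature.** If `F` is smooth
with `{F ≤ 0}` compact and `dF ≠ 0` on `{F = 0}`, and `∑ᵢ Hess F_x(vᵢ, vᵢ) > 0` for every
`x ∈ {F = 0}` and every orthonormal `m`-frame `v` of `ker dF_x`, then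
`‖∇F(x)‖⁻¹ ∑ᵢ Hess F_x(vᵢ, vᵢ) ≥ H₀ > 0` uniformly: the set of such pairs `(x, v)` is compact and the
quantity is continuous and positive on it. [folklore] -/
theorem exists_pos_le_hessianFrameSum {F : W → ℝ} (hF : ContDiff ℝ ∞ F)
    (hK : IsCompact {x | F x ≤ 0}) (hreg : ∀ x, F x = 0 → fderiv ℝ F x ≠ 0) {m : ℕ}
    (hH : ∀ x, F x = 0 → ∀ v : Fin m → W, Orthonormal ℝ v → (∀ i, fderiv ℝ F x (v i) = 0) →
      0 < ∑ i, iteratedFDeriv ℝ 2 F x ![v i, v i]) :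
    ∃ H₀ : ℝ, 0 < H₀ ∧ ∀ x, F x = 0 → ∀ v : Fin m → W, Orthonormal ℝ v →
      (∀ i, fderiv ℝ F x (v i) = 0) → H₀ ≤ ‖∇ F x‖⁻¹ * ∑ i, iteratedFDeriv ℝ 2 F x ![v i, v i] := by
  -- the compact set of pairs (point of the zero set, orthonormal frame of `ker dF`)
  set K : Set (W × (Fin m → W)) := {q | F q.1 = 0 ∧ Orthonormal ℝ q.2 ∧
    ∀ i, fderiv ℝ F q.1 (q.2 i) = 0} with hK_def
  set Φ : W × (Fin m → W) → ℝ := fun q ↦ ‖∇ F q.1‖⁻¹ * ∑ i, iteratedFDeriv ℝ 2 F q.1 ![q.2 i, q.2 i]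
    with hΦ_def
  have hFc : Continuous F := hF.continuous
  have hdFc : Continuous (fderiv ℝ F) := hF.continuous_fderiv (by simp)
  have hgrad : Continuous (∇ F) := by
    have : ∇ F = fun x ↦ (InnerProductSpace.toDual ℝ W).symm (fderiv ℝ F x) := rfl
    rw [this]
    exact (InnerProductSpace.toDual ℝ W).symm.continuous.comp hdFc
  have hHess : Continuous (iteratedFDeriv ℝ 2 F) := hF.continuous_iteratedFDeriv (by
    exact_mod_cast (show ((2 : ℕ) : ℕ∞ω) ≤ ∞ from WithTop.coe_le_coe.mpr le_top))
  -- `K` is compact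
  have hKclosed : IsClosed K := by
    have h1 : IsClosed {q : W × (Fin m → W) | F q.1 = 0} := isClosed_eq (hFc.comp continuous_fst) continuous_const
    have h2 : IsClosed {q : W × (Fin m → W) | Orthonormal ℝ q.2} := by
      have : {q : W × (Fin m → W) | Orthonormal ℝ q.2} =
          ⋂ i, ⋂ j, {q | ⟪q.2 i, q.2 j⟫ = if i = j then (1 : ℝ) else 0} := by
        ext q; simp [orthonormal_iff_ite, mem_iInter]
      rw [this]
      refine isClosed_iInter fun i ↦ isClosed_iInter fun j ↦ isClosed_eq ?_ continuous_const
      exact ((continuous_apply i).comp continuous_snd).inner ((continuous_apply j).comp continuous_snd)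
    have h3 : IsClosed {q : W × (Fin m → W) | ∀ i, fderiv ℝ F q.1 (q.2 i) = 0} := by
      have : {q : W × (Fin m → W) | ∀ i, fderiv ℝ F q.1 (q.2 i) = 0} =
          ⋂ i, {q | fderiv ℝ F q.1 (q.2 i) = 0} := by ext q; simp [mem_iInter]
      rw [this]
      refine isClosed_iInter fun i ↦ isClosed_eq ?_ continuous_const
      exact (hdFc.comp continuous_fst).clm_apply ((continuous_apply i).comp continuous_snd)
    have : K = {q : W × (Fin m → W) | F q.1 = 0} ∩ ({q | Orthonormal ℝ q.2} ∩
        {q | ∀ i, fderiv ℝ F q.1 (q.2 i) = 0}) := by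
      ext q; simp [hK_def]
    rw [this]
    exact h1.inter (h2.inter h3)
  have hKsub : K ⊆ {x | F x ≤ 0} ×ˢ closedBall (0 : Fin m → W) 1 := by
    rintro ⟨x, v⟩ ⟨hx, hv, -⟩
    refine ⟨le_of_eq hx, ?_⟩
    rw [mem_closedBall, dist_zero_right, pi_norm_le_iff_of_nonneg zero_le_one]
    exact fun i ↦ (hv.1 i).le
  have hKc : IsCompact K :=
    (hK.prod (isCompact_closedBall _ _)).of_isClosed_subset hKclosed hKsub
  -- `Φ` is continuous on `K`
  have hΦc : ContinuousOn Φ K := by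
    have hsum : Continuous fun q : W × (Fin m → W) ↦ ∑ i, iteratedFDeriv ℝ 2 F q.1 ![q.2 i, q.2 i] := by
      refine continuous_finsetSum _ fun i _ ↦ ?_
      have hv : Continuous fun q : W × (Fin m → W) ↦ (![q.2 i, q.2 i] : Fin 2 → W) := by
        have hc : Continuous fun q : W × (Fin m → W) ↦ q.2 i := (continuous_apply i).comp continuous_snd
        refine continuous_pi fun j ↦ ?_
        fin_cases j
        · exact hc
        · exact hc
      exact continuous_eval.comp ((hHess.comp continuous_fst).prodMk hv)
    refine ContinuousOn.mul ?_ hsum.continuousOn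
    refine ((hgrad.comp continuous_fst).norm.continuousOn).inv₀ fun q hq ↦ ?_
    have hq0 : ∇ F q.1 ≠ 0 := by
      intro h0
      apply hreg q.1 hq.1
      have : fderiv ℝ F q.1 = (InnerProductSpace.toDual ℝ W) (∇ F q.1) := by
        rw [gradient, LinearIsometryEquiv.apply_symm_apply]
      rw [this, h0, map_zero]
    exact norm_ne_zero_iff.2 hq0
  -- minimise
  rcases K.eq_empty_or_nonempty with hKe | hKne
  · refine ⟨1, one_pos, fun x hx v hv hker ↦ ?_⟩
    have : ((x, v) : W × (Fin m → W)) ∈ K := ⟨hx, hv, hker⟩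
    rw [hKe] at this
    exact this.elim
  · obtain ⟨q₀, hq₀K, hmin⟩ := hKc.exists_isMinOn hKne hΦc
    have hq0 : ∇ F q₀.1 ≠ 0 := by
      intro h0
      apply hreg q₀.1 hq₀K.1
      have : fderiv ℝ F q₀.1 = (InnerProductSpace.toDual ℝ W) (∇ F q₀.1) := by
        rw [gradient, LinearIsometryEquiv.apply_symm_apply]
      rw [this, h0, map_zero]
    refine ⟨Φ q₀, mul_pos (inv_pos.2 (norm_pos_iff.2 hq0)) (hH _ hq₀K.1 _ hq₀K.2.1 hq₀K.2.2),
      fun x hx v hv hker ↦ ?_⟩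
    exact hmin (show ((x, v) : W × (Fin m → W)) ∈ K from ⟨hx, hv, hker⟩)

end Literature.Geometry.Riemannian


namespace Literature.Geometry.Riemannian

open Lorentzian Lorentzian.PseudoRiemannianMetric Literature.Topology.FourManifolds
  IsRegularCompactDomain

/-- **A regular compact domain of `ℝᵐ⁺¹` (`m ≥ 1`) whose boundary has positive mean curvature in
Lawson–Michelsohn's sense carries a metric of positive scalar curvature with mean-convex
boundary.** For `h : IsRegularCompactDomain F` (`F` smooth, `{F ≤ 0}` compact, `dF ≠ 0` on
`{F = 0}`) satisfying the conclusion clause of `LawsonMichelsohn1984_surrounding` —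
`∑ᵢ Hess F_x(vᵢ, vᵢ) > 0` for every `x ∈ {F = 0}` and every orthonormal `m`-frame `v` of
`ker dF_x` — the compact manifold with boundary `h.Domain = {F ≤ 0}` satisfies the conclusion
of `Literature.Geometry.Riemannian.Sweeney2026_pscMeanConvex` relative to ANY boundary datum:
apply the big-sphere theorem `pscMeanConvex_of_flatMeanConvexImmersion` to the inclusion
`ι : {F ≤ 0} → ℝᵐ⁺¹` (smooth with injective differentials, `mfderiv_incl_injective`) and the unit
gradient `Y = ∇F/‖∇F‖` (`LevelSetMeanCurvature.lean`): `Y` is a flat unit normal along the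
boundary (`F ∘ ι ∘ incl = 0`), OUTWARD (`((dι)⁻¹ Y)₀ = -dF(Y) = -‖∇F‖ < 0`, because the `0`-th
coordinate of the straightening chart at a boundary point is `-F`,
`inverse_mfderiv_incl_apply_zero`), of flat mean curvature `H = ‖∇F‖⁻¹ ∑ᵢ Hess F(vᵢ, vᵢ)`
(`meanCurvature_unitGradient_eq_sum`) `≥ H₀ > 0` uniformly (`exists_pos_le_hessianFrameSum`,
compactness). This closes the GEOMETRIC half of the route "Lawson–Michelsohn ⇒ Sweeney,
Prop. 1.2" for `n ≥ 4`; what remains of the fact is topological (realising a compact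
contractible `X` as such a domain, up to diffeomorphism — `pscMeanConvex_of_diffeomorph`).
[cite: Sweeney2026, Prop. 1.2] -/
theorem pscMeanConvex_of_hessianMeanConvexDomain {m : ℕ} (hm : 1 ≤ m)
    {F : EuclideanSpace ℝ (Fin (m + 1)) → ℝ} (h : IsRegularCompactDomain F)
    (hH : ∀ x, F x = 0 → ∀ v : Fin m → EuclideanSpace ℝ (Fin (m + 1)), Orthonormal ℝ v →
      (∀ i, fderiv ℝ F x (v i) = 0) → 0 < ∑ i, iteratedFDeriv ℝ 2 F x ![v i, v i])
    (bX : BoundaryData (𝓡∂ (m + 1)) h.Domain (𝓡 m)) :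
    ∃ g : PseudoRiemannianMetric (𝓡∂ (m + 1)) ∞ (EuclideanSpace ℝ (Fin (m + 1)))
        (TangentSpace (𝓡∂ (m + 1)) : h.Domain → Type _),
    ∃ _ : g.HasLeviCivita, ∃ hf : g.IsSpacelikeImmersion (𝓡 m) bX.incl,
    ∃ ν : NormalField (𝓡∂ (m + 1)) bX.incl,
      g.IsRiemannian ∧ (∀ x, 0 < g.scalarCurvature x) ∧ g.IsUnitNormal (𝓡 m) bX.incl ν 1 ∧
      ContMDiff (𝓡 m) (𝓡∂ (m + 1)).tangent ∞
        (fun z ↦ (TotalSpace.mk' (EuclideanSpace ℝ (Fin (m + 1))) (bX.incl z) (ν z) :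
          TangentBundle (𝓡∂ (m + 1)) h.Domain)) ∧
      (∀ z, (show EuclideanSpace ℝ (Fin (m + 1)) from ν z) 0 < 0) ∧
      ∀ z, 0 < g.meanCurvature bX.incl contMDiff_pullbackBilin_holds hf ν z := by
  haveI := (euclideanMetric (EuclideanSpace ℝ (Fin (m + 1)))).hasLeviCivita
  have hι : ContMDiff (𝓡∂ (m + 1)) 𝓘(ℝ, EuclideanSpace ℝ (Fin (m + 1))) ∞ (Domain.incl h) :=
    Domain.contMDiff_incl h hm
  have hι' : ∀ x, Injective (mfderiv (𝓡∂ (m + 1)) 𝓘(ℝ, EuclideanSpace ℝ (Fin (m + 1)))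
      (Domain.incl h) x) := mfderiv_incl_injective h hm
  have hincl : ContMDiff (𝓡 m) (𝓡∂ (m + 1)) ∞ bX.incl := bX.isSmoothEmbedding.contMDiff
  have hf : ContMDiff (𝓡 m) 𝓘(ℝ, EuclideanSpace ℝ (Fin (m + 1))) ∞ (Domain.incl h ∘ bX.incl) :=
    hι.comp hincl
  -- the boundary lies in the zero set, where the gradient does not vanish
  have hbd : ∀ z, F (Domain.incl h (bX.incl z)) = 0 := fun z ↦
    (Domain.mem_boundary_iff h _).1 (bX.incl_mem_boundary z)
  have hgrad_eq : ∀ x, fderiv ℝ F x = (InnerProductSpace.toDual ℝ _) (∇ F x) := fun x ↦ by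
    rw [gradient, LinearIsometryEquiv.apply_symm_apply]
  have hgrad_ne : ∀ z, ∇ F (Domain.incl h (bX.incl z)) ≠ 0 := fun z h0 ↦
    h.fderiv_ne_zero _ (hbd z) (by rw [hgrad_eq, h0, map_zero])
  -- `dF` kills the tangent vectors of the boundary
  have hdF : ∀ z (w : TangentSpace (𝓡 m) z), fderiv ℝ F (Domain.incl h (bX.incl z))
      (mfderiv (𝓡 m) 𝓘(ℝ, EuclideanSpace ℝ (Fin (m + 1))) (Domain.incl h ∘ bX.incl) z w) = 0 := by
    intro z w
    have hmd : MDifferentiableAt (𝓡 m) 𝓘(ℝ, EuclideanSpace ℝ (Fin (m + 1)))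
        (Domain.incl h ∘ bX.incl) z := (hf z).mdifferentiableAt (by simp)
    have hcomp : HasMFDerivAt (𝓡 m) 𝓘(ℝ, ℝ) (F ∘ (Domain.incl h ∘ bX.incl)) z
        ((fderiv ℝ F (Domain.incl h (bX.incl z))).comp
          (mfderiv (𝓡 m) 𝓘(ℝ, EuclideanSpace ℝ (Fin (m + 1))) (Domain.incl h ∘ bX.incl) z)) :=
      ((h.contDiff.differentiable (by simp)) _).hasFDerivAt.hasMFDerivAt.comp z hmd.hasMFDerivAt
    have hconst : F ∘ (Domain.incl h ∘ bX.incl) = fun _ ↦ (0 : ℝ) := funext fun z ↦ hbd z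
    have h0 : HasMFDerivAt (𝓡 m) 𝓘(ℝ, ℝ) (F ∘ (Domain.incl h ∘ bX.incl)) z
        (0 : TangentSpace (𝓡 m) z →L[ℝ] TangentSpace 𝓘(ℝ, ℝ) ((F ∘ (Domain.incl h ∘ bX.incl)) z)) := by
      rw [hconst]
      exact hasMFDerivAt_const (0 : ℝ) z
    have := congrArg (fun f : TangentSpace (𝓡 m) z →L[ℝ] ℝ ↦ f w) (hcomp.mfderiv.symm.trans h0.mfderiv)
    exact this
  -- the uniform lower bound for the Hessian mean curvature
  obtain ⟨H₀, hH₀, hle⟩ := exists_pos_le_hessianFrameSum h.contDiff h.isCompact h.fderiv_ne_zero hH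
  refine pscMeanConvex_of_flatMeanConvexImmersion m hm h.Domain bX hι hι' (Y := unitGradient F)
    (fun z ↦ contDiffAt_unitGradient h.contDiff (hgrad_ne z)) (fun z ↦ norm_unitGradient (hgrad_ne z))
    (fun z w ↦ inner_unitGradient_eq_zero (hdF z w)) (fun z ↦ ?_) ⟨H₀, hH₀, fun z ↦ ?_⟩
  · -- outwardness: `((dι)⁻¹ Y)₀ = -dF(Y) = -‖∇F‖ < 0`
    have key := inverse_mfderiv_incl_apply_zero h hm (bX.incl z) (hbd z)
      (unitGradient F (Domain.incl h (bX.incl z)))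
    refine lt_of_eq_of_lt key ?_
    rw [← inner_gradient_eq_fderiv, unitGradient, inner_smul_right, real_inner_self_eq_norm_sq,
      neg_neg_iff_pos]
    have hn : 0 < ‖∇ F (Domain.incl h (bX.incl z))‖ := norm_pos_iff.2 (hgrad_ne z)
    positivity
  · -- mean curvature: `H = ‖∇F‖⁻¹ Σ Hess F(vᵢ, vᵢ) ≥ H₀`
    obtain ⟨b, hbo, hbk, hHz⟩ := meanCurvature_unitGradient_eq_sum h.contDiff
      contMDiff_pullbackBilin_holds (isSpacelikeImmersion_euclidean_comp_incl m bX hι hι') (y := z)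
      BoundarylessManifold.isInteriorPoint (hgrad_ne z) (hdF z) (m := m) finrank_euclideanSpace_fin
    exact (hle _ (hbd z) _ hbo hbk).trans_eq hHz.symm

end Literature.Geometry.Riemannian


end
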